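import Literature.Combinatorics.Optimization.ShellLawGeneratingPolynomial
import HarnessLib

/-!
# Pointwise bounds for a shell law through its hypergeometric components: the good/far mixture
# inequality at a single point, the one-component lower bound, and the size of a shell

Continuation of `ShellLawGeneratingPolynomial.lean` (§3: the generating polynomial of the shell law of the
block statistic `|U ∩ H|` is the nonnegative combination
`G_S(c+2s,c) = Σ_{Y ∈ halfSets(S,c)} Σ_{α ≤ s} C(a_Y,α)·X^{|Y∩H|+2α}·H_{b_Y,d_Y,s−α}` of shifted hypergeometric
generating polynomials; §5: `(∇²)^m law_S(t,·)(c)` is `|Shell_S(t,c)|⁻¹` times the coefficient sequence of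
`(1−X)^{2m}·G_S(t,c)`). That file turns the decomposition into `ℓ¹` (total-variation) smoothness bounds
(Röllin–Ross's "the smoothness of a mixture is at most the mixture of the smoothnesses",
[Röllin–Ross 2015, Lemma 3.3]). This file is the POINTWISE companion: the value of an iterated difference of
the shell law AT ONE POINT `i`, compared with the value of the shell law at a nearby REFERENCE POINT `y₀`.

* §1 (abstract mixtures of shifted polynomials with nonnegative coefficients) `coeff_mixture`,
  `eval_one_mixture`, and **`abs_coeff_mixture_le_of_good_far`**: if every GOOD component `κ` satisfies the
  relative bound `|((1−X)^j·X^{σ_κ}H_κ)_i| ≤ E·(X^{σ_κ}H_κ)_{y₀}` and every other (FAR) component the absolute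
  bound `|((1−X)^j·X^{σ_κ}H_κ)_i| ≤ A·H_κ(1)`, then
  `|((1−X)^j·G)_i| ≤ E·G_{y₀} + A·Σ_{κ far} w_κ H_κ(1) ≤ E·G_{y₀} + A·G(1)` for `G = Σ_κ w_κ X^{σ_κ} H_κ`
  — the pointwise form of [Röllin–Ross 2015, Lemma 3.3] (conditioning), with the far components priced by
  their mass.
* §2 (the shell instance) `nab2_iter_shellLaw_natCast_eq` (the dictionary of `ShellLawGeneratingPolynomial` §5
  at a natural point, exposed), **`abs_nab2_iter_shellLaw_le_of_good_far`**: for a `π`-stable ground set `S`,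
  block `H`, level `c`, `s` full edges and any predicate GOOD on the components `(Y, α)`,
  `|(∇²)^m law_S(c+2s,·)(c)(i)| ≤ E·law_S(c+2s,c;y₀) + A` as soon as the good components obey the relative
  bound at `(i, y₀)` and the far ones the absolute bound (`Σ_{Y,α} C(a_Y,α)·C(b_Y+d_Y,s−α) = |Shell_S(c+2s,c)|`);
  **`component_le_shellLaw`**: `C(a_Y,α)·(H_{b_Y,d_Y,s−α})_{y₀−|Y∩H|−2α} ≤ |Shell_S(c+2s,c)|·law_S(c+2s,c;y₀)`
  for every single component (all the others are nonnegative) — the entry point of a window LOWER bound.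
* §3 (sizes) **`card_shellIn_eq_card_halfSets_mul_choose`**: `|Shell_S(c+2s,c)| = |halfSets(S,c)|·C(|S|/2−c, s)`
  (Vandermonde in each half-set fibre), `halfSets_one_eq_image` / **`card_halfSets_one`**: `|halfSets(S,1)| = |S|`.

All PROVED, 0 sorry, no definitions, no named facts. Cell pnp-psdrank (prover g24; MEMO-26 §7 Steps 2–4/6:
the mixture layer of the [BULK] input of Theorems brick 123 `ChebyshevTracialDesignCrossingPlaneBulkConditional`;
the per-component inputs are the pointwise hypergeometric bounds of
`Probability/Distributions/PoissonBinomialTilting` §9–§11).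

## References
* [RollinRoss2010] A. Röllin, N. Ross, *Local limit theorems via Landau–Kolmogorov inequalities*,
  Bernoulli 21 (2015) 851–880, §3 Lemma 3.3 (conditioning / mixtures), Lemma 3.1 (the difference operators).
* [Rothvoss2017] T. Rothvoß, *The matching polytope has exponential extension complexity*, J. ACM 64
  (2017), §2 (PDF pp. 5–6): cuts, the partition of a cut by a perfect matching, the level classes.
* [VatutinMikhailov1983] V. A. Vatutin, V. G. Mikhailov, Theory Probab. Appl. 27 (1983) 734–743, §2 (the
  hypergeometric generating polynomial).
-/

noncomputable section

open Finset Polynomial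

namespace Literature.Combinatorics.Optimization

namespace ShellStep

open Literature.Combinatorics.StablePolynomials

variable {n : ℕ} {π : Fin n → Fin n}

/-! ### §1 Abstract mixtures of shifted polynomials: coefficients, mass, the good/far inequality -/

/-- Coefficients of a mixture `Σ_κ C(w_κ)·X^{σ_κ}·H_κ` after multiplication by a fixed polynomial `R`:
`(R·G)_i = Σ_κ w_κ·(R·X^{σ_κ}H_κ)_i`. [cite: RollinRoss2010, §3 (Lemma 3.3)] -/
theorem coeff_mul_mixture {ι : Type*} (s : Finset ι) (w : ι → ℝ) (σ : ι → ℕ) (Hκ : ι → ℝ[X])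
    (R : ℝ[X]) (i : ℕ) :
    (R * ∑ κ ∈ s, C (w κ) * X ^ (σ κ) * Hκ κ).coeff i =
      ∑ κ ∈ s, w κ * (R * (X ^ (σ κ) * Hκ κ)).coeff i := by
  rw [mul_sum, finsetSum_coeff]
  refine sum_congr rfl fun κ _ => ?_
  rw [show R * (C (w κ) * X ^ (σ κ) * Hκ κ) = C (w κ) * (R * (X ^ (σ κ) * Hκ κ)) by ring, coeff_C_mul]

/-- Coefficients of a mixture: `G_i = Σ_κ w_κ·(X^{σ_κ}H_κ)_i`. [cite: RollinRoss2010, §3 (Lemma 3.3)] -/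
theorem coeff_mixture {ι : Type*} (s : Finset ι) (w : ι → ℝ) (σ : ι → ℕ) (Hκ : ι → ℝ[X]) (i : ℕ) :
    (∑ κ ∈ s, C (w κ) * X ^ (σ κ) * Hκ κ).coeff i = ∑ κ ∈ s, w κ * (X ^ (σ κ) * Hκ κ).coeff i := by
  have h := coeff_mul_mixture s w σ Hκ 1 i
  simpa only [one_mul] using h

/-- Mass of a mixture: `G(1) = Σ_κ w_κ·H_κ(1)`. [cite: RollinRoss2010, §3 (Lemma 3.3)] -/
theorem eval_one_mixture {ι : Type*} (s : Finset ι) (w : ι → ℝ) (σ : ι → ℕ) (Hκ : ι → ℝ[X]) :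
    (∑ κ ∈ s, C (w κ) * X ^ (σ κ) * Hκ κ).eval 1 = ∑ κ ∈ s, w κ * (Hκ κ).eval 1 := by
  rw [eval_finsetSum]
  refine sum_congr rfl fun κ _ => ?_
  rw [eval_mul, eval_mul, eval_C, eval_pow, eval_X, one_pow, mul_one]

/-- A coefficient of a shifted polynomial with nonnegative coefficients is nonnegative.
[cite: RollinRoss2010, §3 (Lemma 3.1)] -/
theorem coeff_X_pow_mul_nonneg {H : ℝ[X]} (hH : ∀ k, 0 ≤ H.coeff k) (σ i : ℕ) :
    0 ≤ (X ^ σ * H).coeff i := by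
  rw [coeff_X_pow_mul']
  split_ifs
  · exact hH _
  · exact le_rfl

/-- A coefficient of a polynomial with nonnegative coefficients is at most its value at `1`.
[cite: RollinRoss2010, §3 (Lemma 3.1)] -/
theorem coeff_le_eval_one_of_nonneg {H : ℝ[X]} (hH : ∀ k, 0 ≤ H.coeff k) (i : ℕ) :
    H.coeff i ≤ H.eval 1 := by
  rw [eval_eq_sum_range' (lt_of_le_of_lt (le_max_left H.natDegree i) (Nat.lt_succ_self _))]
  simp only [one_pow, mul_one]
  exact single_le_sum (fun k _ => hH k) (mem_range.2 (by have := le_max_right H.natDegree i; omega))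

/-- The value at `1` of a polynomial with nonnegative coefficients is nonnegative.
[cite: RollinRoss2010, §3 (Lemma 3.1)] -/
theorem eval_one_nonneg_of_nonneg {H : ℝ[X]} (hH : ∀ k, 0 ≤ H.coeff k) : 0 ≤ H.eval 1 := by
  rw [eval_eq_sum_range]
  simp only [one_pow, mul_one]
  exact sum_nonneg fun k _ => hH k

/-- **The good/far mixture inequality at one point.** Let `G = Σ_{κ ∈ s} w_κ·X^{σ_κ}·H_κ` with `w_κ ≥ 0` and
`H_κ` with nonnegative coefficients, `R` any polynomial (think `(1−X)^j`), `i` a point and `y₀` a reference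
point. If on a set `good ⊆ s` the components obey the RELATIVE bound `|(R·X^{σ_κ}H_κ)_i| ≤ E·(X^{σ_κ}H_κ)_{y₀}`
(`E ≥ 0`) and off it the ABSOLUTE bound `|(R·X^{σ_κ}H_κ)_i| ≤ A·H_κ(1)`, then
`|(R·G)_i| ≤ E·G_{y₀} + A·Σ_{κ ∈ s∖good} w_κ·H_κ(1)`. [cite: RollinRoss2010, §3 (Lemma 3.3: mixtures)] -/
theorem abs_coeff_mixture_le_of_good_far {ι : Type*} [DecidableEq ι] (s good : Finset ι) (hgood : good ⊆ s)
    (w : ι → ℝ) (σ : ι → ℕ) (Hκ : ι → ℝ[X]) (R : ℝ[X]) (i y₀ : ℕ) {E A : ℝ} (hE : 0 ≤ E)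
    (hw : ∀ κ ∈ s, 0 ≤ w κ) (hH : ∀ κ ∈ s, ∀ k, 0 ≤ (Hκ κ).coeff k)
    (hgoodb : ∀ κ ∈ good, |(R * (X ^ (σ κ) * Hκ κ)).coeff i| ≤ E * (X ^ (σ κ) * Hκ κ).coeff y₀)
    (hfar : ∀ κ ∈ s \ good, |(R * (X ^ (σ κ) * Hκ κ)).coeff i| ≤ A * (Hκ κ).eval 1) :
    |(R * ∑ κ ∈ s, C (w κ) * X ^ (σ κ) * Hκ κ).coeff i| ≤
      E * (∑ κ ∈ s, C (w κ) * X ^ (σ κ) * Hκ κ).coeff y₀ + A * ∑ κ ∈ s \ good, w κ * (Hκ κ).eval 1 := by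
  rw [coeff_mul_mixture, coeff_mixture]
  calc |∑ κ ∈ s, w κ * (R * (X ^ (σ κ) * Hκ κ)).coeff i|
      ≤ ∑ κ ∈ s, |w κ * (R * (X ^ (σ κ) * Hκ κ)).coeff i| := abs_sum_le_sum_abs _ _
    _ = ∑ κ ∈ good, w κ * |(R * (X ^ (σ κ) * Hκ κ)).coeff i| +
          ∑ κ ∈ s \ good, w κ * |(R * (X ^ (σ κ) * Hκ κ)).coeff i| := by
        rw [← sum_sdiff hgood, add_comm]
        congr 1 <;> exact sum_congr rfl fun κ hκ => by
          rw [abs_mul, abs_of_nonneg (hw κ (by first | exact hgood hκ | exact (mem_sdiff.1 hκ).1))]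
    _ ≤ ∑ κ ∈ good, w κ * (E * (X ^ (σ κ) * Hκ κ).coeff y₀) +
          ∑ κ ∈ s \ good, w κ * (A * (Hκ κ).eval 1) :=
        add_le_add (sum_le_sum fun κ hκ => mul_le_mul_of_nonneg_left (hgoodb κ hκ) (hw κ (hgood hκ)))
          (sum_le_sum fun κ hκ => mul_le_mul_of_nonneg_left (hfar κ hκ) (hw κ (mem_sdiff.1 hκ).1))
    _ ≤ E * ∑ κ ∈ s, w κ * (X ^ (σ κ) * Hκ κ).coeff y₀ + A * ∑ κ ∈ s \ good, w κ * (Hκ κ).eval 1 := by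
        rw [mul_sum, mul_sum, ← sum_sdiff hgood]
        have h1 : ∑ κ ∈ good, w κ * (E * (X ^ (σ κ) * Hκ κ).coeff y₀) =
            ∑ κ ∈ good, E * (w κ * (X ^ (σ κ) * Hκ κ).coeff y₀) := sum_congr rfl fun κ _ => by ring
        have h2 : ∑ κ ∈ s \ good, w κ * (A * (Hκ κ).eval 1) =
            ∑ κ ∈ s \ good, A * (w κ * (Hκ κ).eval 1) := sum_congr rfl fun κ _ => by ring
        have h3 : 0 ≤ ∑ κ ∈ s \ good, E * (w κ * (X ^ (σ κ) * Hκ κ).coeff y₀) :=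
          sum_nonneg fun κ hκ => mul_nonneg hE (mul_nonneg (hw κ (mem_sdiff.1 hκ).1)
            (coeff_X_pow_mul_nonneg (hH κ (mem_sdiff.1 hκ).1) _ _))
        rw [h1, h2]; linarith

/-- The far mass is at most the total mass: `Σ_{κ ∈ s∖good} w_κ·H_κ(1) ≤ G(1)`.
[cite: RollinRoss2010, §3 (Lemma 3.3)] -/
theorem far_mass_le_eval_one {ι : Type*} [DecidableEq ι] (s good : Finset ι)
    (w : ι → ℝ) (σ : ι → ℕ) (Hκ : ι → ℝ[X])
    (hw : ∀ κ ∈ s, 0 ≤ w κ) (hH : ∀ κ ∈ s, ∀ k, 0 ≤ (Hκ κ).coeff k) :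
    ∑ κ ∈ s \ good, w κ * (Hκ κ).eval 1 ≤ (∑ κ ∈ s, C (w κ) * X ^ (σ κ) * Hκ κ).eval 1 := by
  rw [eval_one_mixture]
  exact sum_le_sum_of_subset_of_nonneg sdiff_subset fun κ hκ _ =>
    mul_nonneg (hw κ hκ) (eval_one_nonneg_of_nonneg (hH κ hκ))

/-! ### §2 The shell instance: iterated second differences of a shell law at one point -/

section Shell

variable (hπ : ∀ v, π (π v) = v) (hπ' : ∀ v, π v ≠ v)
include hπ hπ'

omit hπ hπ' in
/-- **Dictionary at a natural point** (`ShellLawGeneratingPolynomial` §5, exposed): for `i ∈ ℕ`,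
`(∇²)^m law_S(t,·)(c)(i) = |Shell_S(t,c)|⁻¹·((1−X)^{2m}·G_S(t,c))_i`, and the iterated difference vanishes at
negative arguments. [cite: RollinRoss2010, §3 (the difference operators)] [cite: Rothvoss2017, §2 (PDF p. 6)] -/
theorem nab2_iter_shellLaw_natCast_eq (S H : Finset (Fin n)) (t c m : ℕ) :
    (∀ i : ℕ, nab2^[m] (fun c' x => shellLaw π S H t c' x : Profile) c i =
      (1 / ((shellIn π S t c).card : ℝ)) *
        ((1 - X) ^ (2 * m) * ∑ U ∈ shellIn π S t c, (X : ℝ[X]) ^ (U ∩ H).card).coeff i) ∧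
      ∀ x : ℤ, x < 0 → nab2^[m] (fun c' x => shellLaw π S H t c' x : Profile) c x = 0 :=
  nab2_iter_eq_coeff (fun c' x => shellLaw π S H t c' x : Profile)
    (fun c' => ∑ U ∈ shellIn π S t c', (X : ℝ[X]) ^ (U ∩ H).card)
    (fun c' => 1 / ((shellIn π S t c').card : ℝ))
    (fun c' i => (shellLaw_eq_coeff S H t c').1 i)
    (fun c' x hx => (shellLaw_eq_coeff S H t c').2 x hx) m c

omit hπ hπ' in
/-- The shell law at a natural point times the shell size is the coefficient of the generating polynomial:
`|Shell_S(t,c)|·law_S(t,c;i) = (G_S(t,c))_i`. [cite: Rothvoss2017, §2 (PDF p. 6)] -/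
theorem card_mul_shellLaw_natCast (S H : Finset (Fin n)) (t c i : ℕ) :
    ((shellIn π S t c).card : ℝ) * shellLaw π S H t c i =
      (∑ U ∈ shellIn π S t c, (X : ℝ[X]) ^ (U ∩ H).card).coeff i := by
  rw [coeff_shellGen, shellCount_eq_card_mul_shellLaw]

/-- **THE GOOD/FAR MIXTURE INEQUALITY FOR A SHELL LAW AT ONE POINT.** For a fixed-point-free involution `π`,
a `π`-stable ground set `S`, a block `H`, a level `c`, `s` full edges (`t = c + 2s`), an order `m`, a point
`i ∈ ℕ`, a reference point `y₀ ∈ ℕ`, constants `E, A ≥ 0` and ANY set `good` of components `(Y, α)`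
(`Y ∈ halfSets(S,c)`, `α ≤ s`; the component is the shifted hypergeometric polynomial
`X^{|Y∩H|+2α}·H_{b_Y,d_Y,s−α}` with weight `C(a_Y,α)`): if every good component obeys
`|((1−X)^{2m}·X^{σ}H)_i| ≤ E·(X^{σ}H)_{y₀}` and every other component `|((1−X)^{2m}·X^{σ}H)_i| ≤ A·H(1)`
(`H(1) = C(b_Y+d_Y,s−α)`), then `|(∇²)^m law_S(t,·)(c)(i)| ≤ E·law_S(t,c;y₀) + A`.
[cite: RollinRoss2010, §3 (Lemma 3.3)] [cite: Rothvoss2017, §2 (PDF p. 6)] [cite: VatutinMikhailov1983, §2] -/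
theorem abs_nab2_iter_shellLaw_le_of_good_far {S : Finset (Fin n)} (hS : ∀ v ∈ S, π v ∈ S)
    (H : Finset (Fin n)) (c s m i y₀ : ℕ) {E A : ℝ} (hE : 0 ≤ E) (hA : 0 ≤ A)
    (good : Finset (Finset (Fin n) × ℕ))
    (hgoodb : ∀ Y ∈ halfSets π S c, ∀ α ∈ range (s + 1), (Y, α) ∈ good →
      |((1 - X) ^ (2 * m) * (X ^ ((Y ∩ H).card + 2 * α) *
          hyperGen (reps π (vBH π (strip π S Y) H ∪ vBN π (strip π S Y) H)).card
            (reps π (vDD π (strip π S Y) H)).card (s - α))).coeff i| ≤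
        E * (X ^ ((Y ∩ H).card + 2 * α) *
          hyperGen (reps π (vBH π (strip π S Y) H ∪ vBN π (strip π S Y) H)).card
            (reps π (vDD π (strip π S Y) H)).card (s - α)).coeff y₀)
    (hfar : ∀ Y ∈ halfSets π S c, ∀ α ∈ range (s + 1), (Y, α) ∉ good →
      |((1 - X) ^ (2 * m) * (X ^ ((Y ∩ H).card + 2 * α) *
          hyperGen (reps π (vBH π (strip π S Y) H ∪ vBN π (strip π S Y) H)).card
            (reps π (vDD π (strip π S Y) H)).card (s - α))).coeff i| ≤
        A * ((((reps π (vBH π (strip π S Y) H ∪ vBN π (strip π S Y) H)).card +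
          (reps π (vDD π (strip π S Y) H)).card).choose (s - α) : ℕ) : ℝ)) :
    |nab2^[m] (fun c' x => shellLaw π S H (c + 2 * s) c' x : Profile) c i| ≤
      E * shellLaw π S H (c + 2 * s) c y₀ + A := by
  classical
  -- the mixture, indexed by the product `halfSets × range (s+1)`
  set ι := halfSets π S c ×ˢ range (s + 1) with hι
  set w : Finset (Fin n) × ℕ → ℝ := fun κ =>
    (((reps π (vAA π (strip π S κ.1) H)).card.choose κ.2 : ℕ) : ℝ) with hw
  set σ : Finset (Fin n) × ℕ → ℕ := fun κ => (κ.1 ∩ H).card + 2 * κ.2 with hσ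
  set Hκ : Finset (Fin n) × ℕ → ℝ[X] := fun κ =>
    hyperGen (reps π (vBH π (strip π S κ.1) H ∪ vBN π (strip π S κ.1) H)).card
      (reps π (vDD π (strip π S κ.1) H)).card (s - κ.2) with hHκ
  have hG : ∑ U ∈ shellIn π S (c + 2 * s) c, (X : ℝ[X]) ^ (U ∩ H).card =
      ∑ κ ∈ ι, C (w κ) * X ^ (σ κ) * Hκ κ := by
    rw [shellGen_eq_sum_halfSets_hyperGen hπ hπ' hS H c s, hι, sum_product]
  have hw0 : ∀ κ ∈ ι, 0 ≤ w κ := fun κ _ => Nat.cast_nonneg _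
  have hH0 : ∀ κ ∈ ι, ∀ k, 0 ≤ (Hκ κ).coeff k := fun κ _ k => coeff_hyperGen_nonneg _ _ _ k
  set goodι := ι.filter (fun κ => κ ∈ good) with hgoodι
  have hsub : goodι ⊆ ι := filter_subset _ _
  have hmix := abs_coeff_mixture_le_of_good_far ι goodι hsub w σ Hκ ((1 - X) ^ (2 * m)) i y₀ hE hw0 hH0
    (fun κ hκ => by
      obtain ⟨hκι, hκg⟩ := mem_filter.1 hκ
      obtain ⟨hY, hα⟩ := mem_product.1 hκι
      exact hgoodb κ.1 hY κ.2 hα hκg)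
    (fun κ hκ => by
      obtain ⟨hκι, hκg⟩ := mem_sdiff.1 hκ
      obtain ⟨hY, hα⟩ := mem_product.1 hκι
      have hng : κ ∉ good := fun h => hκg (mem_filter.2 ⟨hκι, h⟩)
      have h := hfar κ.1 hY κ.2 hα hng
      rwa [← eval_one_hyperGen] at h)
  -- the far mass is at most the total mass `|Shell|`
  have hfarmass : ∑ κ ∈ ι \ goodι, w κ * (Hκ κ).eval 1 ≤ ((shellIn π S (c + 2 * s) c).card : ℝ) := by
    refine (far_mass_le_eval_one ι goodι w σ Hκ hw0 hH0).trans ?_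
    rw [← hG, eval_one_shellGen]
  -- translate back to the law
  obtain ⟨hd1, -⟩ := nab2_iter_shellLaw_natCast_eq S H (c + 2 * s) c m
  rw [hd1 i, hG]
  have hy₀ : (∑ κ ∈ ι, C (w κ) * X ^ (σ κ) * Hκ κ).coeff y₀ =
      ((shellIn π S (c + 2 * s) c).card : ℝ) * shellLaw π S H (c + 2 * s) c y₀ := by
    rw [← hG, card_mul_shellLaw_natCast]
  rw [hy₀] at hmix
  by_cases h0 : (shellIn π S (c + 2 * s) c).card = 0
  · -- empty shell: everything vanishes
    have hlaw : shellLaw π S H (c + 2 * s) c y₀ = 0 := by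
      rw [shellLaw, h0, Nat.cast_zero, div_zero]
    rw [h0, Nat.cast_zero, div_zero, zero_mul, abs_zero, hlaw, mul_zero, zero_add]
    exact hA
  · have hcard : (0 : ℝ) < ((shellIn π S (c + 2 * s) c).card : ℝ) := by
      exact_mod_cast Nat.pos_of_ne_zero h0
    rw [abs_mul, abs_of_nonneg (by positivity : (0 : ℝ) ≤ 1 / ((shellIn π S (c + 2 * s) c).card : ℝ))]
    calc 1 / ((shellIn π S (c + 2 * s) c).card : ℝ) *
          |((1 - X) ^ (2 * m) * ∑ κ ∈ ι, C (w κ) * X ^ (σ κ) * Hκ κ).coeff i|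
        ≤ 1 / ((shellIn π S (c + 2 * s) c).card : ℝ) *
          (E * (((shellIn π S (c + 2 * s) c).card : ℝ) * shellLaw π S H (c + 2 * s) c y₀) +
            A * ((shellIn π S (c + 2 * s) c).card : ℝ)) := by
          refine mul_le_mul_of_nonneg_left (hmix.trans ?_) (by positivity)
          exact add_le_add le_rfl (mul_le_mul_of_nonneg_left hfarmass hA)
      _ = E * shellLaw π S H (c + 2 * s) c y₀ + A := by
          field_simp

omit hπ' in
/-- **One component bounds the shell law from below**: for `Y ∈ halfSets(S,c)`, `α ≤ s` and a point `y₀`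
with `|Y∩H| + 2α ≤ y₀`,
`C(a_Y,α)·(H_{b_Y,d_Y,s−α})_{y₀−|Y∩H|−2α} ≤ |Shell_S(c+2s,c)|·law_S(c+2s,c;y₀)` — all other components of
the mixture are nonnegative. [cite: Rothvoss2017, §2 (PDF p. 6)] [cite: VatutinMikhailov1983, §2] -/
theorem component_le_card_mul_shellLaw (hπ' : ∀ v, π v ≠ v) {S : Finset (Fin n)} (hS : ∀ v ∈ S, π v ∈ S)
    (H : Finset (Fin n)) (c s : ℕ) {Y : Finset (Fin n)} (hY : Y ∈ halfSets π S c) {α : ℕ} (hα : α ≤ s)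
    {y₀ : ℕ} (hy : (Y ∩ H).card + 2 * α ≤ y₀) :
    (((reps π (vAA π (strip π S Y) H)).card.choose α : ℕ) : ℝ) *
        (hyperGen (reps π (vBH π (strip π S Y) H ∪ vBN π (strip π S Y) H)).card
          (reps π (vDD π (strip π S Y) H)).card (s - α)).coeff (y₀ - ((Y ∩ H).card + 2 * α)) ≤
      ((shellIn π S (c + 2 * s) c).card : ℝ) * shellLaw π S H (c + 2 * s) c y₀ := by
  classical
  rw [card_mul_shellLaw_natCast, shellGen_eq_sum_halfSets_hyperGen hπ hπ' hS H c s, finsetSum_coeff]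
  have hterm : ∀ Y' ∈ halfSets π S c, ∀ α' ∈ range (s + 1),
      0 ≤ (C (((reps π (vAA π (strip π S Y') H)).card.choose α' : ℕ) : ℝ) * X ^ ((Y' ∩ H).card + 2 * α') *
        hyperGen (reps π (vBH π (strip π S Y') H ∪ vBN π (strip π S Y') H)).card
          (reps π (vDD π (strip π S Y') H)).card (s - α')).coeff y₀ := by
    intro Y' _ α' _
    rw [mul_assoc, coeff_C_mul]
    exact mul_nonneg (Nat.cast_nonneg _) (coeff_X_pow_mul_nonneg (coeff_hyperGen_nonneg _ _ _) _ _)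
  simp only [finsetSum_coeff]
  refine le_trans ?_ (single_le_sum (fun Y' hY' => sum_nonneg fun α' hα' => hterm Y' hY' α' hα') hY)
  refine le_trans ?_ (single_le_sum (fun α' hα' => hterm Y hY α' hα') (mem_range.2 (Nat.lt_succ_of_le hα)))
  rw [mul_assoc, coeff_C_mul, coeff_X_pow_mul', if_pos hy]

/-! ### §3 Sizes: `|Shell_S(c+2s,c)| = |halfSets(S,c)|·C(|S|/2 − c, s)`, `|halfSets(S,1)| = |S|` -/

omit hπ hπ' in
/-- Vandermonde in the form `Σ_{α ≤ s} C(a,α)·C(m,s−α) = C(a+m,s)`. [cite: VatutinMikhailov1983, §2] -/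
theorem sum_range_choose_mul_choose (a m s : ℕ) :
    ∑ α ∈ range (s + 1), a.choose α * m.choose (s - α) = (a + m).choose s := by
  rw [Nat.add_choose_eq, Finset.Nat.sum_antidiagonal_eq_sum_range_succ (fun i j => a.choose i * m.choose j) s]

/-- **The size of a shell**: `|Shell_S(c+2s,c)| = |halfSets(S,c)|·C(|S|/2 − c, s)` — choose the half-set,
then `s` of the remaining `|S|/2 − c` edges (the half-set decomposition evaluated at `X = 1`, Vandermonde in
each fibre). [cite: Rothvoss2017, §2 (PDF p. 6)] -/
theorem card_shellIn_eq_card_halfSets_mul_choose {S : Finset (Fin n)} (hS : ∀ v ∈ S, π v ∈ S) (c s : ℕ) :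
    (shellIn π S (c + 2 * s) c).card = (halfSets π S c).card * (S.card / 2 - c).choose s := by
  classical
  have h := card_shellIn_eq_sum_halfSets_types hπ hπ' hS (∅ : Finset (Fin n)) c s
  have hfib : ∀ Y ∈ halfSets π S c, ∑ α ∈ range (s + 1),
      (((reps π (vAA π (strip π S Y) ∅)).card.choose α : ℕ) : ℝ) *
        ((((reps π (vBH π (strip π S Y) ∅ ∪ vBN π (strip π S Y) ∅)).card +
          (reps π (vDD π (strip π S Y) ∅)).card).choose (s - α) : ℕ) : ℝ) =
      (((S.card / 2 - c).choose s : ℕ) : ℝ) := by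
    intro Y hY
    have hN := typeReps_strip_eq hπ hπ' hS ∅ hY
    have : ∑ α ∈ range (s + 1), (((reps π (vAA π (strip π S Y) ∅)).card.choose α : ℕ) : ℝ) *
        ((((reps π (vBH π (strip π S Y) ∅ ∪ vBN π (strip π S Y) ∅)).card +
          (reps π (vDD π (strip π S Y) ∅)).card).choose (s - α) : ℕ) : ℝ) =
        ((∑ α ∈ range (s + 1), (reps π (vAA π (strip π S Y) ∅)).card.choose α *
          ((reps π (vBH π (strip π S Y) ∅ ∪ vBN π (strip π S Y) ∅)).card +
            (reps π (vDD π (strip π S Y) ∅)).card).choose (s - α) : ℕ) : ℝ) := by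
      push_cast; rfl
    rw [this, sum_range_choose_mul_choose, hN]
  rw [sum_congr rfl hfib, sum_const, nsmul_eq_mul] at h
  exact_mod_cast h

omit hπ hπ' in
/-- The admissible half-sets at level `1` are the singletons of `S`. [cite: Rothvoss2017, §2 (PDF p. 6)] -/
theorem halfSets_one_eq_image (hπ' : ∀ v, π v ≠ v) (S : Finset (Fin n)) :
    halfSets π S 1 = S.image fun v => ({v} : Finset (Fin n)) := by
  ext Y
  rw [mem_halfSets, mem_image, card_eq_one]
  constructor
  · rintro ⟨hYS, ⟨v, rfl⟩, _⟩
    exact ⟨v, hYS (mem_singleton_self v), rfl⟩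
  · rintro ⟨v, hv, rfl⟩
    refine ⟨singleton_subset_iff.2 hv, ⟨v, rfl⟩, fun w hw => ?_⟩
    rw [mem_singleton] at hw ⊢
    subst hw
    exact hπ' w

omit hπ hπ' in
/-- `|halfSets(S,1)| = |S|`. [cite: Rothvoss2017, §2 (PDF p. 6)] -/
theorem card_halfSets_one (hπ' : ∀ v, π v ≠ v) (S : Finset (Fin n)) : (halfSets π S 1).card = S.card := by
  rw [halfSets_one_eq_image hπ' S, card_image_of_injective _ (fun v w h => singleton_injective h)]

/-- **The size of a level-`1` shell**: `|Shell_S(2s+1,1)| = |S|·C(|S|/2 − 1, s)` (choose the half-vertex, then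
`s` full edges among the other `|S|/2 − 1`). [cite: Rothvoss2017, §2 (PDF p. 6)] -/
theorem card_shellIn_one (S : Finset (Fin n)) (hS : ∀ v ∈ S, π v ∈ S) (s : ℕ) :
    (shellIn π S (1 + 2 * s) 1).card = S.card * (S.card / 2 - 1).choose s := by
  rw [card_shellIn_eq_card_halfSets_mul_choose hπ hπ' hS 1 s, card_halfSets_one hπ' S]

end Shell

end ShellStep

end Literature.Combinatorics.Optimization

end
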